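import Literature.NumberTheory.EllipticCurves.EisensteinSeriesTwoCharacter
import Literature.NumberTheory.EllipticCurves.EisensteinSeriesNebentypusQExpansion
import Literature.NumberTheory.LFunctions.DirichletLValueBernoulli
import HarnessLib

/-!
# The `q`-expansion of the two-character Eisenstein series `E_k^{ψ,φ}`

Topic `Literature/NumberTheory/EllipticCurves`; namespace
`Literature.NumberTheory.EllipticCurves.ModularForms`.  THEOREMS ONLY (no definition, no named
fact).

For Dirichlet characters `ψ` modulo `u` and `φ` modulo `v`, `k ≥ 3`, we study the lattice sum

  `G^{ψ,φ}(z) = ∑_{(c,d) ∈ ℤ²} ψ(c) φ̄(d) (v c z + d)^{-k}`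

(Diamond–Shurman's `G_k^{ψ,φ}` up to the normalisation of §4.5) exactly as the tree treats
`G_ψ = ∑ ψ(d)(Ncz+d)^{-k}` (`EisensteinSeriesNebentypusLattice/QExpansion`, the case `ψ = 𝟙`):

* `summable_eisLatticeTwoChar`, `eisLatticeTwoChar_eq_tsum_rows` — absolute convergence and
  `G^{ψ,φ} = ∑_m ψ(m) R_m`, `R_m = ∑_d φ̄(d)(vmz+d)^{-k}` the tree's rows for `(v, φ̄)`;
* `eisLatticeTwoChar_eq_qExpansion` — for `φ` primitive and `ψ(-1)φ(-1) = (-1)^k`: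
  `G^{ψ,φ}(z) = 2 ψ(0) L(k, φ̄) + 2 (v^{-k}(-2πi)^k/(k-1)!) W(φ̄) ∑_{n ≥ 1} σ_{k-1}^{ψ,φ}(n) qⁿ`,
  `σ_{k-1}^{ψ,φ}(n) = ∑_{d ∣ n} ψ(n/d) φ(d) d^{k-1}` (Diamond–Shurman Thm. 4.5.1);
* `eisLatticeTwoChar_eq_LFunction_mul_eisensteinTwoChar` —
  `G^{ψ,φ} = L(k, ψφ̄) · E_k^{ψ,φ}` with the coprime-pairs series `eisensteinTwoChar` of
  `EisensteinSeriesTwoCharacter` and the product character `ψφ̄` modulo `uv`.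

## References

* F. Diamond, J. Shurman, *A First Course in Modular Forms*, GTM 228 (2005), §4.5 (Thm. 4.5.1),
  §4.6. [DiamondShurman2005]
* T. Miyake, *Modular Forms*, Springer (2006), §7.1, Thm. 7.1.3. [Miyake2006]
-/

noncomputable section

open Complex UpperHalfPlane EisensteinSeries Filter Finset
open scoped Real

namespace Literature.NumberTheory.EllipticCurves.ModularForms

/-! ### Two-weight resummation -/

section Resummation

/-- The double family `(m, d) ↦ w₁(m) w₂(d) d^k r^{md}` on `ℕ₊²` is summable (`‖r‖ < 1`,
`|w₁|, |w₂| ≤ 1`). [folklore] -/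
theorem summable_prod_weight₂_mul_pow (k : ℕ) {r : ℂ} (hr : ‖r‖ < 1) (w₁ w₂ : ℕ → ℂ)
    (hw₁ : ∀ d, ‖w₁ d‖ ≤ 1) (hw₂ : ∀ d, ‖w₂ d‖ ≤ 1) :
    Summable fun c : ℕ+ × ℕ+ ↦ w₁ c.1 * w₂ c.2 * (c.2 : ℂ) ^ k * r ^ (c.1 * c.2 : ℕ) := by
  refine Summable.of_norm_bounded (summable_prod_mul_pow k hr).norm fun c ↦ ?_
  rw [mul_assoc, mul_assoc, norm_mul, norm_mul, ← mul_assoc]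
  refine mul_le_of_le_one_left (norm_nonneg _) ?_
  exact mul_le_one₀ (hw₁ _) (norm_nonneg _) (hw₂ _)

/-- **Two-weight resummation**: `∑_{(m,d)} w₁(m) w₂(d) d^k r^{md} = ∑_n (∑_{d∣n} w₁(n/d) w₂(d) d^k) rⁿ`.
[folklore] -/
theorem tsum_prod_weight₂_mul_pow_eq_tsum_divisorSum (k : ℕ) {r : ℂ} (hr : ‖r‖ < 1)
    (w₁ w₂ : ℕ → ℂ) (hw₁ : ∀ d, ‖w₁ d‖ ≤ 1) (hw₂ : ∀ d, ‖w₂ d‖ ≤ 1) :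
    ∑' c : ℕ+ × ℕ+, w₁ c.1 * w₂ c.2 * (c.2 : ℂ) ^ k * r ^ (c.1 * c.2 : ℕ) =
      ∑' n : ℕ+, (∑ d ∈ (n : ℕ).divisors, w₁ ((n : ℕ) / d) * w₂ d * (d : ℂ) ^ k) * r ^ (n : ℕ) := by
  have hs' := sigmaAntidiagonalEquivProd.summable_iff.mpr
    (summable_prod_weight₂_mul_pow k hr w₁ w₂ hw₁ hw₂)
  simp only [Function.comp_def] at hs'
  rw [← sigmaAntidiagonalEquivProd.tsum_eq, hs'.tsum_sigma]
  refine tsum_congr fun n ↦ ?_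
  rw [tsum_fintype, Finset.sum_mul]
  simp only [sigmaAntidiagonalEquivProd, divisorsAntidiagonalFactors, Equiv.coe_fn_mk, PNat.mk_coe]
  rw [Finset.univ_eq_attach,
    (n : ℕ).divisorsAntidiagonal.sum_attach fun x : ℕ × ℕ ↦
      w₁ x.1 * w₂ x.2 * (x.2 : ℂ) ^ k * r ^ (x.1 * x.2),
    Nat.sum_divisorsAntidiagonal' fun x y ↦ w₁ x * w₂ y * (y : ℂ) ^ k * r ^ (x * y)]
  refine Finset.sum_congr rfl fun d hd ↦ ?_
  rw [Nat.div_mul_cancel (Nat.dvd_of_mem_divisors hd)]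

end Resummation

/-! ### The lattice sum `G^{ψ,φ}` and its rows -/

section Lattice

variable {u v : ℕ} [NeZero u] [NeZero v] (k : ℕ) (ψ : DirichletCharacter ℂ u)
  (φ : DirichletCharacter ℂ v) (z : ℍ)

omit [NeZero u] in
/-- **Absolute convergence of `G^{ψ,φ} = ∑ ψ(c) φ̄(d) (vcz+d)^{-k}`** (`k ≥ 3`). [folklore] -/
theorem summable_eisLatticeTwoChar (hk : 3 ≤ k) :
    Summable fun w : Fin 2 → ℤ ↦ ψ (w 0) * φ⁻¹ (w 1) * eisSummand k ![(v : ℤ) * w 0, w 1] z := by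
  have hs : Summable fun w : Fin 2 → ℤ ↦ ‖eisSummand (k : ℤ) ![(v : ℤ) * w 0, w 1] z‖ :=
    (summable_norm_eisSummand (by exact_mod_cast hk) z).comp_injective (scaleFst_injective (N := v))
  refine Summable.of_norm_bounded hs fun w ↦ ?_
  rw [norm_mul, norm_mul]
  refine mul_le_of_le_one_left (norm_nonneg _) ?_
  exact mul_le_one₀ (ψ.norm_le_one _) (norm_nonneg _) (φ⁻¹.norm_le_one _)

omit [NeZero u] in
/-- The summand of `G^{ψ,φ}` on `ℤ × ℤ` is summable (`k ≥ 3`). [folklore] -/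
theorem summable_eisLatticeTwoChar_prod (hk : 3 ≤ k) :
    Summable fun x : ℤ × ℤ ↦ ψ x.1 * φ⁻¹ x.2 * ((v : ℂ) * x.1 * z + x.2) ^ (-(k : ℤ)) := by
  refine (finTwoArrowEquiv ℤ).summable_iff.mp <| (summable_eisLatticeTwoChar k ψ φ z hk).congr ?_
  intro w
  simp [eisSummand]

omit [NeZero u] in
/-- **`G^{ψ,φ} = ∑_{m ∈ ℤ} ψ(m) R_m`** with the tree's rows `R_m = ∑_d φ̄(d)(vmz+d)^{-k}`. [folklore] -/
theorem eisLatticeTwoChar_eq_tsum_rows (hk : 3 ≤ k) :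
    ∑' w : Fin 2 → ℤ, ψ (w 0) * φ⁻¹ (w 1) * eisSummand k ![(v : ℤ) * w 0, w 1] z =
      ∑' m : ℤ, ψ m * ∑' d : ℤ, φ⁻¹ d * ((v : ℂ) * m * z + d) ^ (-(k : ℤ)) := by
  rw [← (finTwoArrowEquiv ℤ).symm.tsum_eq]
  simp only [finTwoArrowEquiv_symm_apply, Matrix.cons_val_one, Matrix.cons_val_fin_one,
    Matrix.cons_val_zero, eisSummand, Int.cast_mul, Int.cast_natCast]
  rw [(summable_eisLatticeTwoChar_prod k ψ φ z hk).tsum_prod]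
  refine tsum_congr fun m ↦ ?_
  simp_rw [mul_assoc]
  exact tsum_mul_left

omit [NeZero u] in
/-- The weighted rows `m ↦ ψ(m) R_m` are summable. [folklore] -/
theorem summable_weighted_rows (hk : 3 ≤ k) :
    Summable fun m : ℤ ↦ ψ m * ∑' d : ℤ, φ⁻¹ d * ((v : ℂ) * m * z + d) ^ (-(k : ℤ)) := by
  have := (summable_eisLatticeTwoChar_prod k ψ φ z hk).prod
  refine this.congr fun m ↦ ?_
  simp only [mul_assoc]
  exact tsum_mul_left

omit [NeZero u] [NeZero v] in
/-- **Row symmetry with the joint parity**: `ψ(-m) R_{-m} = ψ(m) R_m` when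
`ψ(-1) φ(-1) = (-1)^k`. [folklore] -/
theorem weightedRow_neg (hpar : ψ (-1) * φ (-1) = (-1) ^ k) (m : ℤ) :
    ψ ((-m : ℤ)) * ∑' d : ℤ, φ⁻¹ d * ((v : ℂ) * ((-m : ℤ) : ℂ) * z + d) ^ (-(k : ℤ)) =
      ψ m * ∑' d : ℤ, φ⁻¹ d * ((v : ℂ) * m * z + d) ^ (-(k : ℤ)) := by
  rw [← (Equiv.neg ℤ).tsum_eq, ← tsum_mul_left, ← tsum_mul_left]
  refine tsum_congr fun d ↦ ?_
  rw [Equiv.neg_apply]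
  have h : ((v : ℂ) * ((-m : ℤ) : ℂ) * z + ((-d : ℤ) : ℂ)) = -((v : ℂ) * m * z + d) := by
    push_cast
    ring
  rw [h, Int.cast_neg, Int.cast_neg, ← neg_one_mul ((d : ℤ) : ZMod v), ← neg_one_mul ((m : ℤ) : ZMod u),
    map_mul, map_mul, neg_eq_neg_one_mul ((v : ℂ) * m * z + d), mul_zpow]
  have hφ : φ⁻¹ (-1) = φ (-1) := by
    rw [MulChar.inv_apply_eq_inv']
    have h2 : φ (-1) * φ (-1) = 1 := by rw [← map_mul, neg_one_mul, neg_neg, map_one]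
    exact (eq_inv_of_mul_eq_one_left h2).symm
  have h1 : ((-1 : ℂ) ^ k) * (-1 : ℂ) ^ (-(k : ℤ)) = 1 := by
    rw [_root_.zpow_neg, zpow_natCast, mul_inv_cancel₀ (pow_ne_zero _ (neg_ne_zero.mpr one_ne_zero))]
  rw [hφ]
  calc ψ (-1) * ψ (m : ZMod u) * (φ (-1) * φ⁻¹ (d : ZMod v) *
        ((-1 : ℂ) ^ (-(k : ℤ)) * ((v : ℂ) * m * z + d) ^ (-(k : ℤ))))
      = (ψ (-1) * φ (-1)) * (-1 : ℂ) ^ (-(k : ℤ)) *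
          (ψ (m : ZMod u) * (φ⁻¹ (d : ZMod v) * ((v : ℂ) * m * z + d) ^ (-(k : ℤ)))) := by ring
    _ = ψ (m : ZMod u) * (φ⁻¹ (d : ZMod v) * ((v : ℂ) * m * z + d) ^ (-(k : ℤ))) := by
        rw [hpar, h1, one_mul]

/-- **The row `m = 0` with its weight**: `ψ(0) R_0 = ψ(0) · 2 L(k, φ̄)` (both sides vanish unless
`u = 1`, when the joint parity is the parity of `φ`). [folklore] -/
theorem weightedRow_zero (hk : 3 ≤ k) (hpar : ψ (-1) * φ (-1) = (-1) ^ k) :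
    ψ ((0 : ℤ)) * ∑' d : ℤ, φ⁻¹ d * ((v : ℂ) * ((0 : ℤ) : ℂ) * z + d) ^ (-(k : ℤ)) =
      ψ 0 * (2 * φ⁻¹.LFunction k) := by
  rw [Int.cast_zero]
  by_cases h0 : ψ 0 = 0
  · rw [h0, zero_mul, zero_mul]
  · have hu : IsUnit (0 : ZMod u) := by
      by_contra hnu; exact h0 (MulChar.map_nonunit _ hnu)
    have h01 : (0 : ZMod u) = 1 := isUnit_zero_iff.mp hu
    have hψ1 : ψ (-1) = 1 := by
      rw [show (-1 : ZMod u) = 1 from by rw [← h01, neg_zero], map_one]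
    rw [hψ1, one_mul] at hpar
    have hparφ : φ⁻¹ (-1) = (-1) ^ k := by
      rw [MulChar.inv_apply_eq_inv', hpar, ← inv_pow, inv_neg_one]
    rw [eisLatticeCharRow_zero k φ⁻¹ z hk hparφ]

/-- **The `q`-expansion of `G^{ψ,φ}`** (Diamond–Shurman Thm. 4.5.1; Miyake Thm. 7.1.3): for `φ`
primitive and `ψ(-1)φ(-1) = (-1)^k`, `k ≥ 3`,
`G^{ψ,φ}(z) = 2 ψ(0) L(k, φ̄) + 2 ((-2πi)^k W(φ̄) / (v^k (k-1)!)) ∑_{n ≥ 1} σ_{k-1}^{ψ,φ}(n) qⁿ`,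
`σ_{k-1}^{ψ,φ}(n) = ∑_{d ∣ n} ψ(n/d) φ(d) d^{k-1}`, `W(φ̄) = gaussSum φ⁻¹ stdAddChar`.
[cite: DiamondShurman2005, §4.5 Thm. 4.5.1] [cite: Miyake2006, Thm. 7.1.3] -/
theorem eisLatticeTwoChar_eq_qExpansion (hk : 3 ≤ k) (hφ : φ.IsPrimitive)
    (hpar : ψ (-1) * φ (-1) = (-1) ^ k) :
    ∑' w : Fin 2 → ℤ, ψ (w 0) * φ⁻¹ (w 1) * eisSummand k ![(v : ℤ) * w 0, w 1] z =
      2 * (ψ 0 * φ⁻¹.LFunction k) +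
      2 * (((v : ℂ) ^ k)⁻¹ * ((-2 * π * Complex.I) ^ k / (k - 1).factorial) *
          gaussSum φ⁻¹ (ZMod.stdAddChar (N := v))) *
        ∑' n : ℕ+, (∑ d ∈ (n : ℕ).divisors, ψ (((n : ℕ) / d : ℕ)) * φ d * (d : ℂ) ^ (k - 1)) *
          cexp (2 * π * Complex.I * z) ^ (n : ℕ) := by
  rw [eisLatticeTwoChar_eq_tsum_rows k ψ φ z hk]
  have heven : Function.Even fun m : ℤ ↦
      ψ m * ∑' d : ℤ, φ⁻¹ d * ((v : ℂ) * m * z + d) ^ (-(k : ℤ)) :=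
    fun m ↦ by simpa using weightedRow_neg k ψ φ z hpar m
  rw [tsum_int_eq_zero_add_two_mul_tsum_pnat heven (summable_weighted_rows k ψ φ z hk)]
  have h0 := weightedRow_zero k ψ φ z hk hpar
  rw [h0, nsmul_eq_mul, Nat.cast_ofNat, ← mul_assoc (ψ 0), mul_comm (ψ 0) 2, mul_assoc (2 : ℂ) (ψ 0),
    mul_assoc (2 : ℂ) (_ * _)]
  congr 2
  have hpos : ∀ m : ℕ+, (0 : ℤ) < ((m : ℕ) : ℤ) := fun m ↦ by exact_mod_cast m.pos
  have hφ' : φ⁻¹.IsPrimitive := Literature.NumberTheory.LFunctions.isPrimitive_inv φ hφ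
  rw [show (∑' m : ℕ+, ψ (((m : ℕ) : ℤ)) *
      ∑' d : ℤ, φ⁻¹ d * ((v : ℂ) * ((m : ℕ) : ℤ) * z + d) ^ (-(k : ℤ))) =
      ∑' m : ℕ+, ((v : ℂ) ^ k)⁻¹ * ((-2 * π * Complex.I) ^ k / (k - 1).factorial) *
        gaussSum φ⁻¹ (ZMod.stdAddChar (N := v)) *
        (ψ (((m : ℕ) : ℤ)) * ∑' n : ℕ, φ n * (n : ℂ) ^ (k - 1) *
          cexp (2 * π * Complex.I * ((m : ℕ) : ℤ) * z) ^ n)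
      from tsum_congr fun m ↦ by
        rw [eisLatticeCharRow_pos k φ⁻¹ z hk hφ' (hpos m), inv_inv]; ring, tsum_mul_left]
  congr 1
  have hq : ‖cexp (2 * π * Complex.I * z)‖ < 1 := norm_exp_two_pi_I_lt_one z
  have hinner : ∀ m : ℕ+,
      ψ (((m : ℕ) : ℤ)) * ∑' n : ℕ, φ n * (n : ℂ) ^ (k - 1) *
          cexp (2 * π * Complex.I * ((m : ℕ) : ℤ) * z) ^ n =
        ∑' n : ℕ+, ψ (m : ℕ) * φ (n : ℕ) * ((n : ℕ) : ℂ) ^ (k - 1) *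
          cexp (2 * π * Complex.I * z) ^ ((m : ℕ) * n : ℕ) := by
    intro m
    have h0 : (fun n : ℕ ↦ φ n * (n : ℂ) ^ (k - 1) *
        cexp (2 * π * Complex.I * ((m : ℕ) : ℤ) * z) ^ n) 0 = 0 := by
      simp only [Nat.cast_zero, zero_pow (show k - 1 ≠ 0 by omega), mul_zero, zero_mul]
    rw [← tsum_pnat_eq_tsum_of_eq_zero (M := ℂ) h0, ← tsum_mul_left]
    refine tsum_congr fun n ↦ ?_
    rw [pow_mul, ← Complex.exp_nat_mul (2 * π * Complex.I * z) m]
    have : (2 * π * Complex.I * (((m : ℕ) : ℤ) : ℂ) * z) = (m : ℕ) * (2 * π * Complex.I * z) := by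
      push_cast; ring
    rw [this, Int.cast_natCast]
    ring
  simp_rw [hinner]
  rw [← (summable_prod_weight₂_mul_pow (k - 1) hq (fun d ↦ ψ d) (fun d ↦ φ d)
    (fun d ↦ ψ.norm_le_one _) (fun d ↦ φ.norm_le_one _)).tsum_prod,
    tsum_prod_weight₂_mul_pow_eq_tsum_divisorSum (k - 1) hq (fun d ↦ ψ d) (fun d ↦ φ d)
      (fun d ↦ ψ.norm_le_one _) (fun d ↦ φ.norm_le_one _)]

end Lattice

/-! ### `G^{ψ,φ} = L(k, ψφ̄) · E_k^{ψ,φ}` -/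

section Coprime

variable {u v : ℕ} [NeZero u] [NeZero v] (k : ℕ) (ψ : DirichletCharacter ℂ u)
  (φ : DirichletCharacter ℂ v) (z : ℍ)

/-- The product character `ψ φ̄` modulo `uv` at a natural number `r`: `ψ(r) φ̄(r)`. [folklore] -/
theorem changeLevel_mul_changeLevel_inv_apply_natCast (r : ℕ) :
    (DirichletCharacter.changeLevel (dvd_mul_right u v) ψ *
        DirichletCharacter.changeLevel (dvd_mul_left v u) φ⁻¹) (r : ZMod (u * v)) =
      ψ r * φ⁻¹ r := by
  rw [MulChar.mul_apply]
  by_cases hc : IsUnit (r : ZMod (u * v))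
  · obtain ⟨w, hw⟩ := hc
    rw [← hw, DirichletCharacter.changeLevel_eq_cast_of_dvd ψ,
      DirichletCharacter.changeLevel_eq_cast_of_dvd φ⁻¹, hw, ZMod.cast_natCast (dvd_mul_right u v),
      ZMod.cast_natCast (dvd_mul_left v u)]
  · rw [MulChar.map_nonunit _ hc, zero_mul]
    have hc' : ¬ r.Coprime (u * v) := by rwa [← ZMod.isUnit_iff_coprime]
    obtain ⟨ℓ, hℓ, hℓr, hℓuv⟩ := Nat.Prime.not_coprime_iff_dvd.mp hc'
    rcases (Nat.Prime.dvd_mul hℓ).mp hℓuv with hℓu | hℓv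
    · have : ¬ IsUnit (r : ZMod u) := by
        rw [ZMod.isUnit_iff_coprime]
        exact fun hcop ↦ hℓ.one_lt.ne' (Nat.eq_one_of_dvd_coprimes hcop hℓr hℓu)
      rw [MulChar.map_nonunit _ this, zero_mul]
    · have : ¬ IsUnit (r : ZMod v) := by
        rw [ZMod.isUnit_iff_coprime]
        exact fun hcop ↦ hℓ.one_lt.ne' (Nat.eq_one_of_dvd_coprimes hcop hℓr hℓv)
      rw [MulChar.map_nonunit _ this, mul_zero]

omit [NeZero u] [NeZero v] in
/-- Homogeneity: `ψ(rc) φ̄(rd) (v r c z + r d)^{-k} = ψ(r) φ̄(r) r^{-k} · ψ(c) φ̄(d) (vcz+d)^{-k}`.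
[folklore] -/
theorem latticeTwoCharSummand_nsmul (hk : k ≠ 0) (r : ℕ) (w : Fin 2 → ℤ) :
    ψ ((r • w) 0) * φ⁻¹ ((r • w) 1) * eisSummand k ![(v : ℤ) * (r • w) 0, (r • w) 1] z =
      ψ r * φ⁻¹ r * ((r : ℂ) ^ k)⁻¹ *
        (ψ (w 0) * φ⁻¹ (w 1) * eisSummand k ![(v : ℤ) * w 0, w 1] z) := by
  simp only [Pi.smul_apply, nsmul_eq_mul, eisSummand, Matrix.cons_val_zero, Matrix.cons_val_one,
    Matrix.cons_val_fin_one]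
  push_cast
  rw [map_mul, map_mul]
  rcases eq_or_ne r 0 with rfl | hr
  · simp [zero_pow hk, _root_.zero_zpow _ (show (-(k : ℤ)) ≠ 0 by omega)]
  · have h : ((v : ℂ) * ((r : ℂ) * (w 0 : ℂ)) * (z : ℂ) + (r : ℂ) * (w 1 : ℂ)) =
        (r : ℂ) * ((v : ℂ) * w 0 * z + w 1) := by ring
    rw [h, mul_zpow, _root_.zpow_neg (r : ℂ), zpow_natCast]
    ring

/-- **`G^{ψ,φ} = L(k, ψφ̄) · ∑_{(c,d) coprime} ψ(c) φ̄(d) (vcz+d)^{-k}`** (`k ≥ 3`).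
[cite: DiamondShurman2005, §4.5 (proof of Thm. 4.5.1)] -/
theorem eisLatticeTwoChar_eq_LFunction_mul_tsum_coprime (hk : 3 ≤ k) :
    ∑' w : Fin 2 → ℤ, ψ (w 0) * φ⁻¹ (w 1) * eisSummand k ![(v : ℤ) * w 0, w 1] z =
      (DirichletCharacter.changeLevel (dvd_mul_right u v) ψ *
          DirichletCharacter.changeLevel (dvd_mul_left v u) φ⁻¹).LFunction k *
        ∑' w : gammaSet 1 1 0, ψ (w.1 0) * φ⁻¹ (w.1 1) * eisSummand k ![(v : ℤ) * w.1 0, w.1 1] z := by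
  set Λ := DirichletCharacter.changeLevel (dvd_mul_right u v) ψ *
    DirichletCharacter.changeLevel (dvd_mul_left v u) φ⁻¹ with hΛ
  set f : (Fin 2 → ℤ) → ℂ := fun w ↦ ψ (w 0) * φ⁻¹ (w 1) * eisSummand k ![(v : ℤ) * w 0, w 1] z
    with hf
  have hfs : Summable f := summable_eisLatticeTwoChar k ψ φ z hk
  have hfs' : Summable fun x : (Σ r : ℕ, gammaSet 1 r 0) ↦ f x.2 := by
    have := gammaSetDivGcdSigmaEquiv.symm.summable_iff.mpr hfs
    simpa [Function.comp_def] using this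
  have hr : ∀ r : ℕ, ∑' w : gammaSet 1 r 0, f w =
      ψ r * φ⁻¹ r * ((r : ℂ) ^ k)⁻¹ * ∑' w : gammaSet 1 1 0, f w := by
    intro r
    have h1 : ∀ w : gammaSet 1 r 0, f w = ψ r * φ⁻¹ r * ((r : ℂ) ^ k)⁻¹ * f (divIntMap r w.1) := by
      intro w
      conv_lhs => rw [gammaSet_eq_gcd_mul_divIntMap w.2]
      exact latticeTwoCharSummand_nsmul k ψ φ z (by omega) r _
    rw [tsum_congr h1, tsum_mul_left]
    rcases eq_or_ne r 0 with rfl | hr0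
    · simp [zero_pow (show k ≠ 0 by omega)]
    · haveI : NeZero r := ⟨hr0⟩
      congr 1
      exact (gammaSetDivGcdEquiv r).tsum_eq (fun w : gammaSet 1 1 0 ↦ f w)
  have hL : ∑' r : ℕ, ψ r * φ⁻¹ r * ((r : ℂ) ^ k)⁻¹ = Λ.LFunction k := by
    have hre : 1 < ((k : ℂ)).re := by simp; omega
    rw [DirichletCharacter.LFunction_eq_LSeries Λ hre, LSeries]
    refine tsum_congr fun r ↦ ?_
    rcases eq_or_ne r 0 with rfl | hr0
    · simp [zero_pow (show k ≠ 0 by omega)]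
    · rw [LSeries.term_of_ne_zero hr0, Complex.cpow_natCast, div_eq_mul_inv, hΛ,
        changeLevel_mul_changeLevel_inv_apply_natCast]
  calc ∑' w, f w = ∑' x : (Σ r : ℕ, gammaSet 1 r 0), f x.2 := by
        rw [← gammaSetDivGcdSigmaEquiv.symm.tsum_eq]
        rfl
    _ = ∑' (r : ℕ) (w : gammaSet 1 r 0), f w := hfs'.tsum_sigma
    _ = ∑' r : ℕ, ψ r * φ⁻¹ r * ((r : ℂ) ^ k)⁻¹ * ∑' w : gammaSet 1 1 0, f w := tsum_congr hr
    _ = _ := by rw [tsum_mul_right, hL]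

/-- The fibres `gammaSet (uv) 1 (v c₁, d₀)` are pairwise disjoint. [folklore] -/
theorem pairwise_disjoint_gammaSet_tcVec :
    Pairwise (Function.onFun Disjoint fun p : ZMod u × ZMod (u * v) ↦
      gammaSet (u * v) 1 (tcVec p.1 p.2)) := by
  intro p q hpq
  refine pairwise_disjoint_gammaSet (N := u * v) (r := 1) fun h ↦ hpq ?_
  have h0 := congr_fun h 0
  have h1 := congr_fun h 1
  simp only [tcVec, Matrix.cons_val_zero, Matrix.cons_val_one, Matrix.cons_val_fin_one] at h0 h1
  exact Prod.ext (vMul_injective h0) h1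

omit [NeZero v] in
/-- A coprime pair `(c, d)` with `d` prime to `v` gives `(vc, d) ∈ gammaSet (uv) 1 (v c̄, d̄)`.
[folklore] -/
theorem scaleFst_mem_gammaSet_tcVec {w : Fin 2 → ℤ} (hw : w ∈ gammaSet 1 1 0)
    (hu : IsUnit ((w 1 : ℤ) : ZMod v)) :
    (![(v : ℤ) * w 0, w 1] : Fin 2 → ℤ) ∈
      gammaSet (u * v) 1 (tcVec ((w 0 : ℤ) : ZMod u) ((w 1 : ℤ) : ZMod (u * v))) := by
  refine ⟨?_, ?_⟩
  · funext i
    fin_cases i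
    · simp [tcVec, vMul_intCast]
    · simp [tcVec]
  · simp only [Matrix.cons_val_zero, Matrix.cons_val_one, Matrix.cons_val_fin_one]
    rw [mem_gammaSet_one] at hw
    rw [← Int.isCoprime_iff_gcd_eq_one]
    exact IsCoprime.mul_left (isCoprime_of_isUnit_intCast hu).symm hw

/-- **`∑_{(c,d) coprime} ψ(c) φ̄(d) (vcz+d)^{-k} = E_k^{ψ,φ}(z)`** (`eisensteinTwoChar` of
`EisensteinSeriesTwoCharacter`): the pairs with `gcd(d, v) > 1` contribute `0`, and
`(c, d) ↦ (vc, d)` is a bijection from the remaining coprime pairs onto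
`⋃_{c₁, d₀} gammaSet (uv) 1 (v c₁, d₀)`. [cite: DiamondShurman2005, §4.5–4.6] -/
theorem tsum_coprime_eq_eisensteinTwoChar (hk : 3 ≤ k) :
    ∑' w : gammaSet 1 1 0, ψ (w.1 0) * φ⁻¹ (w.1 1) * eisSummand k ![(v : ℤ) * w.1 0, w.1 1] z =
      eisensteinTwoChar k ψ φ z := by
  have hv0 : (v : ℤ) ≠ 0 := by exact_mod_cast NeZero.ne v
  set ι : (Fin 2 → ℤ) → (Fin 2 → ℤ) := fun w ↦ ![(v : ℤ) * w 0, w 1] with hι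
  set h : (Fin 2 → ℤ) → ℂ := fun x ↦ ψ ((x 0 / v : ℤ)) * φ⁻¹ (x 1) * eisSummand k x z with hh
  have hS : Summable h := by
    refine Summable.of_norm_bounded (summable_norm_eisSummand (k := k) (by exact_mod_cast hk) z)
      fun x ↦ ?_
    rw [hh, norm_mul, norm_mul]
    refine mul_le_of_le_one_left (norm_nonneg _) ?_
    exact mul_le_one₀ (ψ.norm_le_one _) (norm_nonneg _) (φ⁻¹.norm_le_one _)
  set S : Set (Fin 2 → ℤ) := ι '' gammaSet 1 1 0 with hSdef
  set T : ZMod u × ZMod (u * v) → Set (Fin 2 → ℤ) := fun p ↦ gammaSet (u * v) 1 (tcVec p.1 p.2)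
    with hT
  set U : Set (Fin 2 → ℤ) := ⋃ p, T p with hU
  -- (1) the left-hand side as a sum over `S`
  have h1 : ∑' w : gammaSet 1 1 0, ψ (w.1 0) * φ⁻¹ (w.1 1) * eisSummand k ![(v : ℤ) * w.1 0, w.1 1] z =
      ∑' x : S, h x := by
    rw [hSdef, tsum_image h (scaleFst_injective (N := v)).injOn]
    refine tsum_congr fun w ↦ ?_
    simp [hh, Int.mul_ediv_cancel_left _ hv0]
  -- (2) `U ⊆ S` and the indicators agree
  have hUS : U ⊆ S := by
    intro x hx
    obtain ⟨p, hxp⟩ := Set.mem_iUnion.mp hx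
    obtain ⟨hres, hgcd⟩ := hxp
    have h0 : ((x 0 : ℤ) : ZMod v) = 0 := by
      have := congr_fun hres 0
      simp only [Function.comp_apply, tcVec, Matrix.cons_val_zero] at this
      have h2 := congrArg (ZMod.castHom (dvd_mul_left v u) (ZMod v)) this
      rwa [map_intCast, castHom_vMul] at h2
    obtain ⟨c, hc⟩ := (ZMod.intCast_zmod_eq_zero_iff_dvd _ v).mp h0
    refine ⟨![c, x 1], ?_, ?_⟩
    · rw [mem_gammaSet_one]
      simp only [Matrix.cons_val_zero, Matrix.cons_val_one, Matrix.cons_val_fin_one]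
      have : IsCoprime (x 0) (x 1) := Int.isCoprime_iff_gcd_eq_one.mpr hgcd
      rw [hc] at this
      exact this.of_mul_left_right
    · funext i
      fin_cases i <;> simp [hι, hc]
  have hind : S.indicator h = U.indicator h := by
    funext x
    by_cases hxU : x ∈ U
    · rw [Set.indicator_of_mem hxU, Set.indicator_of_mem (hUS hxU)]
    · rw [Set.indicator_of_notMem hxU]
      by_cases hxS : x ∈ S
      · rw [Set.indicator_of_mem hxS, hh]
        dsimp only
        have hnu : ¬ IsUnit ((x 1 : ℤ) : ZMod v) := by
          intro hu1
          apply hxU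
          obtain ⟨w, hw, rfl⟩ := hxS
          have hu' : IsUnit ((w 1 : ℤ) : ZMod v) := by simpa [hι] using hu1
          refine Set.mem_iUnion.mpr ⟨(((w 0 : ℤ) : ZMod u), ((w 1 : ℤ) : ZMod (u * v))), ?_⟩
          have := scaleFst_mem_gammaSet_tcVec (u := u) hw hu'
          simpa [hT, hι] using this
        rw [φ⁻¹.map_nonunit hnu, mul_zero, zero_mul]
      · rw [Set.indicator_of_notMem hxS]
  -- (3) `∑_{x ∈ S} h = ∑_{x ∈ U} h`
  have h3 : ∑' x : S, h x = ∑' x : U, h x := by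
    rw [_root_.tsum_subtype, hind, ← _root_.tsum_subtype]
  -- (4) `∑_{x ∈ U} h = ∑_p ∑_{x ∈ T p} h`
  have hdisj : Pairwise (Function.onFun Disjoint T) := pairwise_disjoint_gammaSet_tcVec
  have h4 : ∑' x : U, h x = ∑ p : ZMod u × ZMod (u * v), ∑' x : T p, h x := by
    rw [← (Set.unionEqSigmaOfDisjoint hdisj).symm.tsum_eq]
    simp only [Set.coe_unionEqSigmaOfDisjoint_symm_apply]
    have hs4 : Summable fun q : (Σ p : ZMod u × ZMod (u * v), T p) ↦ h q.2 := by
      have := (Set.unionEqSigmaOfDisjoint hdisj).symm.summable_iff.mpr (hS.subtype U)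
      simpa [Function.comp_def] using this
    rw [hs4.tsum_sigma, tsum_fintype]
  -- (5) each fibre
  have h5 : ∀ p : ZMod u × ZMod (u * v), ∑' x : T p, h x =
      tcWeight ψ φ p.1 p.2 * eisensteinSeries (tcVec p.1 p.2) k z := by
    intro p
    simp only [eisensteinSeries, ← tsum_mul_left]
    refine tsum_congr fun x ↦ ?_
    rw [hh]
    dsimp only
    unfold tcWeight
    have hres := x.2.1
    have hx0 := congr_fun hres 0
    have hx1 := congr_fun hres 1
    simp only [Function.comp_apply, tcVec, Matrix.cons_val_zero, Matrix.cons_val_one,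
      Matrix.cons_val_fin_one] at hx0 hx1
    -- `x 0 = v · (x 0 / v)` with `(x 0 / v) ≡ p.1 (mod u)`
    have hdv : (v : ℤ) ∣ x.1 0 := by
      have h2 := congrArg (ZMod.castHom (dvd_mul_left v u) (ZMod v)) hx0
      rw [map_intCast, castHom_vMul] at h2
      exact (ZMod.intCast_zmod_eq_zero_iff_dvd _ v).mp h2
    obtain ⟨c, hc⟩ := hdv
    have hcu : ((c : ℤ) : ZMod u) = p.1 := by
      apply vMul_injective (v := v)
      rw [vMul_intCast, ← hc, hx0]
    have hx1v : ((x.1 1 : ℤ) : ZMod v) = ZMod.castHom (dvd_mul_left v u) (ZMod v) p.2 := by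
      rw [← hx1, map_intCast]
    rw [hc, Int.mul_ediv_cancel_left _ hv0, hcu, hx1v]
  rw [h1, h3, h4]
  simp only [eisensteinTwoChar, h5]
  rw [Fintype.sum_prod_type]

/-- **`G^{ψ,φ} = L(k, ψφ̄) · E_k^{ψ,φ}`** (`k ≥ 3`). [cite: DiamondShurman2005, §4.5–4.6] -/
theorem eisLatticeTwoChar_eq_LFunction_mul_eisensteinTwoChar (hk : 3 ≤ k) :
    ∑' w : Fin 2 → ℤ, ψ (w 0) * φ⁻¹ (w 1) * eisSummand k ![(v : ℤ) * w 0, w 1] z =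
      (DirichletCharacter.changeLevel (dvd_mul_right u v) ψ *
          DirichletCharacter.changeLevel (dvd_mul_left v u) φ⁻¹).LFunction k *
        eisensteinTwoChar k ψ φ z := by
  rw [eisLatticeTwoChar_eq_LFunction_mul_tsum_coprime k ψ φ z hk,
    tsum_coprime_eq_eisensteinTwoChar k ψ φ z hk]

end Coprime

/-! ### The `q`-expansion of `E_k^{ψ,φ}` and of the modular form `eisensteinTwoCharMF` -/

section QExpansionMF

variable {u v : ℕ} [NeZero u] [NeZero v] (k : ℕ) (ψ : DirichletCharacter ℂ u)
  (φ : DirichletCharacter ℂ v)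

/-- Summability of `∑_n σ_k^{ψ,φ}(n) rⁿ` (`‖r‖ < 1`). [folklore] -/
theorem summable_divisorSum₂_mul_pow (k : ℕ) {r : ℂ} (hr : ‖r‖ < 1) (w₁ w₂ : ℕ → ℂ)
    (hw₁ : ∀ d, ‖w₁ d‖ ≤ 1) (hw₂ : ∀ d, ‖w₂ d‖ ≤ 1) :
    Summable fun n : ℕ ↦ (∑ d ∈ n.divisors, w₁ (n / d) * w₂ d * (d : ℂ) ^ k) * r ^ n := by
  refine Summable.of_norm_bounded (summable_norm_pow_mul_geometric_of_norm_lt_one (k + 1) hr)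
    fun n ↦ ?_
  rw [norm_mul, norm_mul, norm_pow, norm_pow, Complex.norm_natCast]
  refine mul_le_mul_of_nonneg_right ?_ (by positivity)
  calc ‖∑ d ∈ n.divisors, w₁ (n / d) * w₂ d * (d : ℂ) ^ k‖ ≤ ∑ d ∈ n.divisors, (d : ℝ) ^ k := by
        refine (norm_sum_le _ _).trans (Finset.sum_le_sum fun d _ ↦ ?_)
        rw [norm_mul, norm_mul, norm_pow, Complex.norm_natCast]
        refine mul_le_of_le_one_left (by positivity) ?_
        exact mul_le_one₀ (hw₁ _) (norm_nonneg _) (hw₂ _)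
    _ ≤ ∑ _d ∈ n.divisors, (n : ℝ) ^ k := Finset.sum_le_sum fun d hd ↦ by
        gcongr
        exact Nat.divisor_le hd
    _ ≤ (n : ℝ) ^ (k + 1) := by
        rw [Finset.sum_const, nsmul_eq_mul, pow_succ']
        gcongr
        exact_mod_cast Nat.card_divisors_le_self n

/-- The normalising constant `β = 2 (-2πi)^k W(φ̄) / (v^k (k-1)! L(k, ψφ̄))` of the higher
`q`-expansion coefficients of `E_k^{ψ,φ}` (an abbreviation, not a new notion). [folklore] -/
def twoCharCoeffConst : ℂ :=
  2 * (((v : ℂ) ^ k)⁻¹ * ((-2 * π * Complex.I) ^ k / (k - 1).factorial) *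
      gaussSum φ⁻¹ (ZMod.stdAddChar (N := v))) /
    (DirichletCharacter.changeLevel (dvd_mul_right u v) ψ *
      DirichletCharacter.changeLevel (dvd_mul_left v u) φ⁻¹).LFunction k

/-- **The `q`-expansion of `E_k^{ψ,φ}`** (`φ` primitive, `ψ(-1)φ(-1) = (-1)^k`, `k ≥ 3`):
`E_k^{ψ,φ}(z) = 2ψ(0)L(k,φ̄)/L(k,ψφ̄) + β ∑_{n ≥ 1} σ_{k-1}^{ψ,φ}(n) qⁿ`.
[cite: DiamondShurman2005, §4.5 Thm. 4.5.1, §4.6] -/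
theorem eisensteinTwoChar_eq_qExpansion (hk : 3 ≤ k) (hφ : φ.IsPrimitive)
    (hpar : ψ (-1) * φ (-1) = (-1) ^ k) (z : ℍ) :
    eisensteinTwoChar k ψ φ z =
      2 * (ψ 0 * φ⁻¹.LFunction k) /
          (DirichletCharacter.changeLevel (dvd_mul_right u v) ψ *
            DirichletCharacter.changeLevel (dvd_mul_left v u) φ⁻¹).LFunction k +
        twoCharCoeffConst k ψ φ *
          ∑' n : ℕ+, (∑ d ∈ (n : ℕ).divisors, ψ (((n : ℕ) / d : ℕ)) * φ d * (d : ℂ) ^ (k - 1)) *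
            cexp (2 * π * Complex.I * z) ^ (n : ℕ) := by
  have hL := LFunction_natCast_ne_zero k (DirichletCharacter.changeLevel (dvd_mul_right u v) ψ *
    DirichletCharacter.changeLevel (dvd_mul_left v u) φ⁻¹) (by omega)
  have h1 := eisLatticeTwoChar_eq_LFunction_mul_eisensteinTwoChar k ψ φ z hk
  rw [eisLatticeTwoChar_eq_qExpansion k ψ φ z hk hφ hpar] at h1
  apply mul_left_cancel₀ hL
  rw [← h1, twoCharCoeffConst]
  field_simp

/-- **The `q`-expansion coefficients of the modular form `E_k^{ψ,φ} ∈ M_k(Γ₁(uv))`**: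
`a₀ = 2ψ(0)L(k,φ̄)/L(k,ψφ̄)` and `aₙ = β σ_{k-1}^{ψ,φ}(n)` for `n ≥ 1`.
[cite: DiamondShurman2005, §4.5 Thm. 4.5.1, §4.6] -/
theorem qExpansion_coeff_eisensteinTwoCharMF (hk : 3 ≤ k) (hφ : φ.IsPrimitive)
    (hpar : ψ (-1) * φ (-1) = (-1) ^ k) (n : ℕ) :
    (qExpansion 1 ⇑(eisensteinTwoCharMF k ψ φ (by exact_mod_cast hk))).coeff n =
      if n = 0 then
        2 * (ψ 0 * φ⁻¹.LFunction k) /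
          (DirichletCharacter.changeLevel (dvd_mul_right u v) ψ *
            DirichletCharacter.changeLevel (dvd_mul_left v u) φ⁻¹).LFunction k
      else twoCharCoeffConst k ψ φ *
        ∑ d ∈ n.divisors, ψ ((n / d : ℕ)) * φ d * (d : ℂ) ^ (k - 1) := by
  set α : ℂ := 2 * (ψ 0 * φ⁻¹.LFunction k) /
    (DirichletCharacter.changeLevel (dvd_mul_right u v) ψ *
      DirichletCharacter.changeLevel (dvd_mul_left v u) φ⁻¹).LFunction k with hα
  set β : ℂ := twoCharCoeffConst k ψ φ with hβ
  set c : ℕ → ℂ := fun m ↦ if m = 0 then α else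
    β * ∑ d ∈ m.divisors, ψ ((m / d : ℕ)) * φ d * (d : ℂ) ^ (k - 1) with hc
  suffices h : ∀ τ : ℍ, HasSum (fun m ↦ c m • Function.Periodic.qParam (1 : ℝ) τ ^ m)
      (eisensteinTwoCharMF k ψ φ (by exact_mod_cast hk) τ) from
    (ModularFormClass.qExpansion_coeff_unique one_pos (by simp) h n).symm
  intro τ
  change HasSum (fun m ↦ c m * Function.Periodic.qParam (1 : ℝ) τ ^ m)
    (eisensteinTwoCharMF k ψ φ (by exact_mod_cast hk) τ)
  have hq : ‖cexp (2 * π * Complex.I * τ)‖ < 1 := norm_exp_two_pi_I_lt_one τ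
  have hS : Summable fun m : ℕ ↦ (∑ d ∈ (m + 1).divisors, ψ (((m + 1) / d : ℕ)) * φ d * (d : ℂ) ^ (k - 1)) *
      cexp (2 * π * Complex.I * τ) ^ (m + 1) :=
    (summable_nat_add_iff 1).mpr
      (summable_divisorSum₂_mul_pow (k - 1) hq (fun d ↦ ψ d) (fun d ↦ φ d)
        (fun d ↦ ψ.norm_le_one _) fun d ↦ φ.norm_le_one _)
  rw [← hasSum_nat_add_iff' 1]
  simp only [Nat.add_eq_zero_iff, one_ne_zero, and_false, ↓reduceIte, Finset.range_one,
    Finset.sum_singleton, pow_zero, mul_one, c, Function.Periodic.qParam, Complex.ofReal_one,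
    div_one]
  have hval : eisensteinTwoCharMF k ψ φ (by exact_mod_cast hk) τ - α =
      β * ∑' m : ℕ, (∑ d ∈ (m + 1).divisors, ψ (((m + 1) / d : ℕ)) * φ d * (d : ℂ) ^ (k - 1)) *
        cexp (2 * π * Complex.I * τ) ^ (m + 1) := by
    rw [coe_eisensteinTwoCharMF, eisensteinTwoChar_eq_qExpansion k ψ φ hk hφ hpar τ, ← hα, ← hβ,
      tsum_pnat_eq_tsum_succ (f := fun m : ℕ ↦
        (∑ d ∈ m.divisors, ψ ((m / d : ℕ)) * φ d * (d : ℂ) ^ (k - 1)) *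
          cexp (2 * π * Complex.I * τ) ^ m)]
    ring
  rw [hval]
  have h := hS.hasSum.mul_left β
  simp only [← mul_assoc] at h
  exact h

end QExpansionMF

end Literature.NumberTheory.EllipticCurves.ModularForms
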